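import Summits.QuantumFields.YangMills.Theorems.BalabanUVNodesN13WindowAtRecord13SepCoPH
import Literature.MathematicalPhysics.QuantumFieldTheory.Balaban1983to89.Node00.Record13SepCoPH

/-!
# Crux K2⁷ `EndpointGivenBR13SepCoPH` (stmt-QuantumFields-20543), LINE 2 «shift-cauchy-everyslope» — THE FIRST RUNGS (scale `k = 0`) OF ITS STUBS S2 `stub_anchor13` AND
# S3 `stub_cont13` AT NODE 00's STAGE-13 RECORD: ANCHOR₀ ⟺ «the merged FIRST β-function has a one-sided limit at `0⁺`» (= the NAMED clause `Node00.Beta0LimitExists` read at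
# `k = 0`) ⟹ K1⁷'s ∕ K2⁷'s `K ≥ 1` WINDOW; CONT₀ ⟺ continuity of ONE real function on `]0, θ.γ]`

Cell `pub-ymgap`, YM-PLAN Track A (HUMAN RULING D-0062 ∕ D-0149), WIDTH SEAT `pub-ymgap-dag-n13-w4` (g0), plan g79 WORDS-2 REBALANCE № 4 («K2⁷ LINE 2 FIRST RUNGS at scale k = 0 of the
record's merged β — the k = 0 instances of `stub_cont13` and of `stub_anchor13`, as count-neutral helpers `--supports stmt-QuantumFields-20543 --as helper`»).  K2⁷ skeleton v2
(plan g79, `D79-K2V2/K2Skeleton13SepCoPHv2.lean` 4bf42851e4bc388d) registers, at every admissible Stage-13 tuple of `SU(2)` data, with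
`β_m := betaMerged F (mergedTermFamilyMatT F 2 (TcanOfRecord F 2) (chiFixed29 F 2 θ.ν θ.ε₂₉) θ.εbg) θ.ρ8 θ.bV`, `β⁰ := beta0OfMerged β_m θ.v₀` and the record's DEFINITIONAL split
`S := oneLoopSplit_betaOfMerged β_m β⁰ θ.γ` ([Balaban1987RG1] (2.12)–(2.14) p. 268): S2 `stub_anchor13 : D4AnchorRecord13` = `AnchorVanishing S` («∀ k, ∀ δ > 0, ∃ γ > 0, ∀ v ∈ Box γ k,
|S.β1 k v| ≤ δ» — each remainder `β¹_{k+1}` is small near the zero history) and S3 `stub_cont13 : ContRecord13` = `BetaContH θ.γ (betaOfMerged β_m β⁰ θ.γ)` (box continuity scale by scale).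
The skeleton and the idea seat's sketch are not tree modules, so their `k = 0` instances are spelled LITERALLY below (general `N`; §4 at the texts' `N = 2`).  COUNT-NEUTRAL.

WHAT THE FIRST RUNGS ARE (kernel, this file).  Length-one box histories are constant (`Fin 1`), `S.β1 0 = 𝟙_{Box θ.γ 0}·(β_m 0 − β⁰ 0)` and `β⁰ 0 = limUnder (𝓝[>] 0) (g ↦ β_m 0 (g))`
(`Node00.beta0OfMerged`; the reference history `θ.v₀ 0` updated at its last slot IS the constant history).  HENCE (§1) at `0 < θ.γ`:
  ANCHOR₀ ⟺ `Tendsto (g ↦ β_m 0 (g)) (𝓝[>] 0) (𝓝 (β⁰ 0))` ⟺ «the merged first β-function has SOME one-sided limit at `0⁺`» ⟺ `Beta0LimitExists β_m θ.v₀` READ AT `k = 0`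
— the «joint-limit = path-limit» clause of S2 is AUTOMATIC at `k = 0` (there is only one path), and any cluster value IS `β⁰_1` (`Filter.Tendsto.limUnder_eq`).  By this seat's
`…N13WindowAtRecord13SepCoPH.window_datumOfRecord₁₃SepCoPH_of_tendsto_betaMerged` (p585485) ANCHOR₀ therefore ALREADY PAYS THE `K ≥ 1` WINDOW at the record — the last conjunct of
K1⁷ `StabilityBAtRecordR13SepCoPH` and the window HYPOTHESIS of K2⁷ itself (§2).  CONT₀ (§3) is `ContinuousOn (g ↦ β_m 0 (g)) (Set.Ioc 0 θ.γ)` — continuity of one real function on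
the half-open interval; it neither implies nor follows from ANCHOR₀ (the limit AT `0` vs continuity AWAY from `0`).  Both are estimates about Bałaban's first renormalisation step
([I] p. 264 «C^∞-function of g … uniformly bounded», (2.13) p. 268 «vanishes at g_k = 0»; NODE O) — DISPLAYED here, NOT discharged.

WHAT THIS FILE PROVES (theorems only, 0 `def`, 0 `sorry`).
* §1 `betaOne_zero_apply` (face) · `beta0_zero_eq_limUnder` (face) · ★★ `tendsto_betaMerged_zero_of_anchorZero` · `beta0_zero_eq_of_tendsto` · ★★ `anchorZero_of_tendsto_betaMerged_zero` ·
  `anchorZero_iff_tendsto` · ★ `anchorZero_iff_beta0LimitExists_zero` · `anchorZero_of_beta0LimitExists`.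
* §2 ★★ `window_datumOfRecord₁₃SepCoPH_of_anchorZero` (ANCHOR₀ ⟹ the window at `datumOfRecord₁₃SepCoPH F N θ h`).
* §3 ★ `contZero_iff_continuousOn_Ioc`.
* §4 (`N = 2`, the skeleton's spelling) `anchorZero₂_iff_beta0LimitExists_zero`, `window₂_datumOfRecord₁₃SepCoPH_of_anchorZero`.

HONEST SCOPE (A6, №189).  Every theorem quantifies over `θ : Stage13HParams F N` (§2: with `h : θ.Provisos₁₃SepCoPH F N`) — inhabited iff K0⁷ (stmt-QuantumFields-20541) — and over the
`k = 0` analytic inputs ANCHOR₀ ∕ CONT₀ ∕ the one-sided limit, all LOCATED (NODE O), none discharged; both sides of every ⟺ are unproved at Bałaban's β.  NOT a proof of `stub_anchor13` or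
`stub_cont13` (their `k = 0` instances only, and only REDUCED); K2⁷ ∕ K1⁷ NOT closed; N13 ∕ N25 ∕ N26 NOT discharged; counts unmoved (typed 28∕28 · discharged 5∕27 · A 5∕28).  One finite
four-torus programme at fixed `ε = L^{−K}`, Bałaban AS PRINTED; the YM mass gap (Clay) is NOT proved by any of this — R4 closes the conditional finite-𝕋⁴ rung `BalabanLadder.UV` only;
nothing continuum ∕ ℝ⁴ ∕ OS.  No `instance`, no `notation`, no `axiom`.
References: [I] = [Balaban1987RG1] CMP **109** (1987): (0.17)–(0.20) pp. 255–256, Thm 2 p. 259, (1.20)–(1.22) p. 264, (2.9) p. 266, (2.12)–(2.14) p. 268; [II] = [Balaban1988RG2Cluster]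
CMP **116** (1988): Lemma 3 (2.38) p. 20; [B16] = [Balaban1989LargeFieldII] CMP **122** (1989): Thm 1 + (0.1) pp. 355–356.
-/

noncomputable section

open scoped Matrix.Norms.L2Operator

namespace Summit.QuantumFields.YangMills.Theorems.BalabanUVNodesK2Line2FirstRungsAtScaleZero

open Literature.MathematicalPhysics.QuantumFieldTheory.Balaban1983to89
open Literature.MathematicalPhysics.QuantumFieldTheory.Balaban1983to89.FlowStep
open Literature.MathematicalPhysics.QuantumFieldTheory.Balaban1983to89.FlowStepRuns
open Literature.MathematicalPhysics.QuantumFieldTheory.Balaban1983to89.DagBinding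
open Literature.MathematicalPhysics.QuantumFieldTheory.Balaban1983to89.T4Continuum (T4Family FiniteEpsData)
open Literature.MathematicalPhysics.QuantumFieldTheory.Balaban1983to89.Node00
open Summit.QuantumFields.YangMills.Theorems.BalabanUVNodesK1WindowFirstStep (const_mem_box_zero_iff)
open Summit.QuantumFields.YangMills.Theorems.BalabanUVNodesN13WindowAtRecord13SepCoPH (window_datumOfRecord₁₃SepCoPH_of_tendsto_betaMerged)
open Filter Topology

variable {F : T4Family} {N : ℕ} [NeZero N]

/-! ## §1. ANCHOR₀ ⟺ the merged first β-function has a one-sided limit at `0⁺` (and the limit IS `β⁰_1`) -/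

section Anchor

/-- FACE: the remainder of the record's definitional split at scale `0` is `𝟙_{]0, θ.γ]^1}(v)·(β_m 0 v − β⁰ 0)` (`Node00.oneLoopSplit_betaOfMerged`, `rfl`).
[cite: Balaban1987RG1, (2.12)–(2.14) p.268 (bookkeeping)] -/
theorem betaOne_zero_apply (θ : Stage13HParams F N) (v : Fin 1 → ℝ) :
    letI := θ.instVβ₁; letI := θ.instVβ₂; letI := θ.instιβ
    (oneLoopSplit_betaOfMerged (betaMerged F (mergedTermFamilyMatT F N (TcanOfRecord F N) (chiFixed29 F N θ.ν θ.ε₂₉) θ.εbg) θ.ρ8 θ.bV)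
        (beta0OfMerged (betaMerged F (mergedTermFamilyMatT F N (TcanOfRecord F N) (chiFixed29 F N θ.ν θ.ε₂₉) θ.εbg) θ.ρ8 θ.bV) θ.v₀) θ.γ).β1 0 v =
      (Box θ.γ 0).indicator
        (fun w => betaMerged F (mergedTermFamilyMatT F N (TcanOfRecord F N) (chiFixed29 F N θ.ν θ.ε₂₉) θ.εbg) θ.ρ8 θ.bV 0 w -
          beta0OfMerged (betaMerged F (mergedTermFamilyMatT F N (TcanOfRecord F N) (chiFixed29 F N θ.ν θ.ε₂₉) θ.εbg) θ.ρ8 θ.bV) θ.v₀ 0) v :=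
  rfl

/-- FACE: the record's first one-loop number IS the `limUnder` along `𝓝[>] 0` of the merged first β-function at constant histories (`Node00.beta0OfMerged`; the reference history
`θ.v₀ 0` updated at its last slot is the constant history — `Fin 1`). [cite: Balaban1987RG1, (2.12)–(2.14) p.268 and (1.22) p.264 (bookkeeping)] -/
theorem beta0_zero_eq_limUnder (θ : Stage13HParams F N) :
    letI := θ.instVβ₁; letI := θ.instVβ₂; letI := θ.instιβ
    beta0OfMerged (betaMerged F (mergedTermFamilyMatT F N (TcanOfRecord F N) (chiFixed29 F N θ.ν θ.ε₂₉) θ.εbg) θ.ρ8 θ.bV) θ.v₀ 0 =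
      limUnder (𝓝[>] (0 : ℝ))
        (fun g : ℝ => betaMerged F (mergedTermFamilyMatT F N (TcanOfRecord F N) (chiFixed29 F N θ.ν θ.ε₂₉) θ.εbg) θ.ρ8 θ.bV 0 (fun _ => g)) := by
  letI := θ.instVβ₁; letI := θ.instVβ₂; letI := θ.instιβ
  have hupd : ∀ g : ℝ, Function.update (θ.v₀ 0) (Fin.last 0) g = fun _ => g := fun g => by
    funext i
    rw [Subsingleton.elim (α := Fin 1) i (Fin.last 0)]
    simp
  show limUnder (𝓝[>] (0 : ℝ)) (fun g : ℝ => betaMerged F _ θ.ρ8 θ.bV 0 (Function.update (θ.v₀ 0) (Fin.last 0) g)) = _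
  simp only [hupd]

/-- ★★ **ANCHOR₀ ⟹ THE ONE-SIDED LIMIT OF THE MERGED FIRST β-FUNCTION EXISTS AND IS `β⁰_1`** (`0 < θ.γ`): the `k = 0` instance of S2 `AnchorVanishing S` — «∀ δ > 0, ∃ γ > 0,
∀ v ∈ ]0, γ]^1, |S.β1 0 v| ≤ δ» — gives `β_m 0 (g) → β⁰ 0` as `g → 0⁺` (below `min γ θ.γ` the remainder IS `β_m 0 (g) − β⁰ 0`).  The «joint-limit = path-limit» clause of S2 is automatic at
`k = 0`: there is only the constant path. [cite: Balaban1987RG1, (2.12)–(2.14) p.268 («vanishes at g_k = 0», k = 0) and (1.22) p.264 (elementary)] -/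
theorem tendsto_betaMerged_zero_of_anchorZero (θ : Stage13HParams F N) (hγθ : 0 < θ.γ)
    (hA : letI := θ.instVβ₁; letI := θ.instVβ₂; letI := θ.instιβ
      ∀ δ : ℝ, 0 < δ → ∃ γ : ℝ, 0 < γ ∧ ∀ v ∈ Box γ 0,
        |(oneLoopSplit_betaOfMerged (betaMerged F (mergedTermFamilyMatT F N (TcanOfRecord F N) (chiFixed29 F N θ.ν θ.ε₂₉) θ.εbg) θ.ρ8 θ.bV)
            (beta0OfMerged (betaMerged F (mergedTermFamilyMatT F N (TcanOfRecord F N) (chiFixed29 F N θ.ν θ.ε₂₉) θ.εbg) θ.ρ8 θ.bV) θ.v₀) θ.γ).β1 0 v| ≤ δ) :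
    letI := θ.instVβ₁; letI := θ.instVβ₂; letI := θ.instιβ
    Tendsto (fun g : ℝ => betaMerged F (mergedTermFamilyMatT F N (TcanOfRecord F N) (chiFixed29 F N θ.ν θ.ε₂₉) θ.εbg) θ.ρ8 θ.bV 0 (fun _ => g))
      (𝓝[>] (0 : ℝ))
      (𝓝 (beta0OfMerged (betaMerged F (mergedTermFamilyMatT F N (TcanOfRecord F N) (chiFixed29 F N θ.ν θ.ε₂₉) θ.εbg) θ.ρ8 θ.bV) θ.v₀ 0)) := by
  letI := θ.instVβ₁; letI := θ.instVβ₂; letI := θ.instιβ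
  set βm := betaMerged F (mergedTermFamilyMatT F N (TcanOfRecord F N) (chiFixed29 F N θ.ν θ.ε₂₉) θ.εbg) θ.ρ8 θ.bV with hβm
  set b₀ : ℝ := beta0OfMerged βm θ.v₀ 0 with hb₀
  rw [Metric.tendsto_nhds]
  intro ε hε
  obtain ⟨γ, hγ, hAγ⟩ := hA (ε / 2) (half_pos hε)
  have hlt : ∀ᶠ g in 𝓝[>] (0 : ℝ), g < min γ θ.γ := (eventually_lt_nhds (lt_min hγ hγθ)).filter_mono nhdsWithin_le_nhds
  have hpos : ∀ᶠ g in 𝓝[>] (0 : ℝ), 0 < g := eventually_mem_nhdsWithin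
  filter_upwards [hlt, hpos] with g hg hg0
  have hgγ : g ≤ γ := hg.le.trans (min_le_left _ _)
  have hgθ : g ≤ θ.γ := hg.le.trans (min_le_right _ _)
  have h := hAγ (fun _ => g) (const_mem_box_zero_iff.mpr ⟨hg0, hgγ⟩)
  rw [betaOne_zero_apply θ, Set.indicator_of_mem (const_mem_box_zero_iff.mpr ⟨hg0, hgθ⟩)] at h
  rw [Real.dist_eq]
  exact lt_of_le_of_lt h (half_lt_self hε)

/-- **ANY ONE-SIDED LIMIT OF THE MERGED FIRST β-FUNCTION IS `β⁰_1`**: `β_m 0 (g) → L` as `g → 0⁺` ⟹ `β⁰ 0 = L` (`β⁰ 0` is the `limUnder` of that very function; `𝓝[>] 0 ≠ ⊥` on `ℝ`).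
[cite: Balaban1987RG1, (2.12)–(2.14) p.268 and (1.22) p.264 (elementary)] -/
theorem beta0_zero_eq_of_tendsto (θ : Stage13HParams F N) {L : ℝ}
    (hlim : letI := θ.instVβ₁; letI := θ.instVβ₂; letI := θ.instιβ
      Tendsto (fun g : ℝ => betaMerged F (mergedTermFamilyMatT F N (TcanOfRecord F N) (chiFixed29 F N θ.ν θ.ε₂₉) θ.εbg) θ.ρ8 θ.bV 0 (fun _ => g))
        (𝓝[>] (0 : ℝ)) (𝓝 L)) :
    letI := θ.instVβ₁; letI := θ.instVβ₂; letI := θ.instιβ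
    beta0OfMerged (betaMerged F (mergedTermFamilyMatT F N (TcanOfRecord F N) (chiFixed29 F N θ.ν θ.ε₂₉) θ.εbg) θ.ρ8 θ.bV) θ.v₀ 0 = L := by
  letI := θ.instVβ₁; letI := θ.instVβ₂; letI := θ.instιβ
  rw [beta0_zero_eq_limUnder θ]
  exact hlim.limUnder_eq

/-- ★★ **THE ONE-SIDED LIMIT ⟹ ANCHOR₀**: if `β_m 0 (g) → L` as `g → 0⁺` then for every `δ > 0` some `γ > 0` has `|S.β1 0 v| ≤ δ` on `]0, γ]^1` (`β⁰ 0 = L` by `beta0_zero_eq_of_tendsto`; on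
the box the remainder is `β_m 0 (v 0) − L`, off it `0`). [cite: Balaban1987RG1, (2.12)–(2.14) p.268 and (1.22) p.264 (elementary)] -/
theorem anchorZero_of_tendsto_betaMerged_zero (θ : Stage13HParams F N) {L : ℝ}
    (hlim : letI := θ.instVβ₁; letI := θ.instVβ₂; letI := θ.instιβ
      Tendsto (fun g : ℝ => betaMerged F (mergedTermFamilyMatT F N (TcanOfRecord F N) (chiFixed29 F N θ.ν θ.ε₂₉) θ.εbg) θ.ρ8 θ.bV 0 (fun _ => g))
        (𝓝[>] (0 : ℝ)) (𝓝 L)) :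
    letI := θ.instVβ₁; letI := θ.instVβ₂; letI := θ.instιβ
    ∀ δ : ℝ, 0 < δ → ∃ γ : ℝ, 0 < γ ∧ ∀ v ∈ Box γ 0,
      |(oneLoopSplit_betaOfMerged (betaMerged F (mergedTermFamilyMatT F N (TcanOfRecord F N) (chiFixed29 F N θ.ν θ.ε₂₉) θ.εbg) θ.ρ8 θ.bV)
          (beta0OfMerged (betaMerged F (mergedTermFamilyMatT F N (TcanOfRecord F N) (chiFixed29 F N θ.ν θ.ε₂₉) θ.εbg) θ.ρ8 θ.bV) θ.v₀) θ.γ).β1 0 v| ≤ δ := by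
  letI := θ.instVβ₁; letI := θ.instVβ₂; letI := θ.instιβ
  have hb₀ := beta0_zero_eq_of_tendsto θ hlim
  set βm := betaMerged F (mergedTermFamilyMatT F N (TcanOfRecord F N) (chiFixed29 F N θ.ν θ.ε₂₉) θ.εbg) θ.ρ8 θ.bV with hβm
  intro δ hδ
  have hev : ∀ᶠ g in 𝓝[>] (0 : ℝ), dist (βm 0 (fun _ => g)) L < δ := Metric.tendsto_nhds.mp hlim δ hδ
  obtain ⟨u, hu, hsub⟩ := mem_nhdsGT_iff_exists_Ioo_subset.mp hev
  have hu0 : (0 : ℝ) < u := hu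
  refine ⟨u / 2, by positivity, fun v hv => ?_⟩
  have hx := (mem_box.mp hv) 0
  rw [betaOne_zero_apply θ]
  by_cases hmem : v ∈ Box θ.γ 0
  · rw [Set.indicator_of_mem hmem, hb₀]
    have hv0 : v = fun _ => v 0 := funext fun i => by rw [Subsingleton.elim (α := Fin 1) i 0]
    have hd : dist (βm 0 (fun _ => v 0)) L < δ := hsub ⟨hx.1, by linarith [hx.2]⟩
    rw [Real.dist_eq] at hd
    rw [← hv0] at hd
    exact hd.le
  · rw [Set.indicator_of_notMem hmem, abs_zero]
    exact hδ.le

/-- **ANCHOR₀ ⟺ `β_m 0 (g) → β⁰ 0` as `g → 0⁺`** (`0 < θ.γ`). [cite: Balaban1987RG1, (2.12)–(2.14) p.268 and (1.22) p.264 (elementary)] -/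
theorem anchorZero_iff_tendsto (θ : Stage13HParams F N) (hγθ : 0 < θ.γ) :
    letI := θ.instVβ₁; letI := θ.instVβ₂; letI := θ.instιβ
    (∀ δ : ℝ, 0 < δ → ∃ γ : ℝ, 0 < γ ∧ ∀ v ∈ Box γ 0,
        |(oneLoopSplit_betaOfMerged (betaMerged F (mergedTermFamilyMatT F N (TcanOfRecord F N) (chiFixed29 F N θ.ν θ.ε₂₉) θ.εbg) θ.ρ8 θ.bV)
            (beta0OfMerged (betaMerged F (mergedTermFamilyMatT F N (TcanOfRecord F N) (chiFixed29 F N θ.ν θ.ε₂₉) θ.εbg) θ.ρ8 θ.bV) θ.v₀) θ.γ).β1 0 v| ≤ δ) ↔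
      Tendsto (fun g : ℝ => betaMerged F (mergedTermFamilyMatT F N (TcanOfRecord F N) (chiFixed29 F N θ.ν θ.ε₂₉) θ.εbg) θ.ρ8 θ.bV 0 (fun _ => g))
        (𝓝[>] (0 : ℝ))
        (𝓝 (beta0OfMerged (betaMerged F (mergedTermFamilyMatT F N (TcanOfRecord F N) (chiFixed29 F N θ.ν θ.ε₂₉) θ.εbg) θ.ρ8 θ.bV) θ.v₀ 0)) := by
  letI := θ.instVβ₁; letI := θ.instVβ₂; letI := θ.instιβ
  exact ⟨tendsto_betaMerged_zero_of_anchorZero θ hγθ, anchorZero_of_tendsto_betaMerged_zero θ⟩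

/-- ★ **ANCHOR₀ ⟺ THE NAMED ONE-LOOP-LIMIT CLAUSE AT THE FIRST STEP** (`0 < θ.γ`): the `k = 0` rung of S2 holds IFF `∃ b, Tendsto (g ↦ β_m 0 (Function.update (θ.v₀ 0) (Fin.last 0) g))
(𝓝[>] 0) (𝓝 b)` — VERBATIM the `k = 0` instance of `Node00.Beta0LimitExists β_m θ.v₀` (chair R434 (c3); already a displayed hypothesis of `…N17AtRecord13*`).  So at the first step S2
asks for NOTHING but the existence of the one-sided limit of the merged first β-function. [cite: Balaban1987RG1, (2.12)–(2.14) p.268 and (1.22) p.264 (elementary)] -/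
theorem anchorZero_iff_beta0LimitExists_zero (θ : Stage13HParams F N) (hγθ : 0 < θ.γ) :
    letI := θ.instVβ₁; letI := θ.instVβ₂; letI := θ.instιβ
    (∀ δ : ℝ, 0 < δ → ∃ γ : ℝ, 0 < γ ∧ ∀ v ∈ Box γ 0,
        |(oneLoopSplit_betaOfMerged (betaMerged F (mergedTermFamilyMatT F N (TcanOfRecord F N) (chiFixed29 F N θ.ν θ.ε₂₉) θ.εbg) θ.ρ8 θ.bV)
            (beta0OfMerged (betaMerged F (mergedTermFamilyMatT F N (TcanOfRecord F N) (chiFixed29 F N θ.ν θ.ε₂₉) θ.εbg) θ.ρ8 θ.bV) θ.v₀) θ.γ).β1 0 v| ≤ δ) ↔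
      ∃ b : ℝ, Tendsto (fun g : ℝ => betaMerged F (mergedTermFamilyMatT F N (TcanOfRecord F N) (chiFixed29 F N θ.ν θ.ε₂₉) θ.εbg) θ.ρ8 θ.bV 0
        (Function.update (θ.v₀ 0) (Fin.last 0) g)) (𝓝[>] (0 : ℝ)) (𝓝 b) := by
  letI := θ.instVβ₁; letI := θ.instVβ₂; letI := θ.instιβ
  have hupd : ∀ g : ℝ, Function.update (θ.v₀ 0) (Fin.last 0) g = fun _ => g := fun g => by
    funext i
    rw [Subsingleton.elim (α := Fin 1) i (Fin.last 0)]
    simp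
  simp only [hupd]
  exact ⟨fun hA => ⟨_, tendsto_betaMerged_zero_of_anchorZero θ hγθ hA⟩, fun ⟨_, hb⟩ => anchorZero_of_tendsto_betaMerged_zero θ hb⟩

/-- **THE NAMED CLAUSE ⟹ ANCHOR₀** (no hypothesis on `θ.γ`): `Node00.Beta0LimitExists β_m θ.v₀` (all `k`) gives the `k = 0` rung of S2 — only its `k = 0` instance is read.
[cite: Balaban1987RG1, (2.12)–(2.14) p.268 (elementary)] -/
theorem anchorZero_of_beta0LimitExists (θ : Stage13HParams F N)
    (hlim : letI := θ.instVβ₁; letI := θ.instVβ₂; letI := θ.instιβ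
      Beta0LimitExists (betaMerged F (mergedTermFamilyMatT F N (TcanOfRecord F N) (chiFixed29 F N θ.ν θ.ε₂₉) θ.εbg) θ.ρ8 θ.bV) θ.v₀) :
    letI := θ.instVβ₁; letI := θ.instVβ₂; letI := θ.instιβ
    ∀ δ : ℝ, 0 < δ → ∃ γ : ℝ, 0 < γ ∧ ∀ v ∈ Box γ 0,
      |(oneLoopSplit_betaOfMerged (betaMerged F (mergedTermFamilyMatT F N (TcanOfRecord F N) (chiFixed29 F N θ.ν θ.ε₂₉) θ.εbg) θ.ρ8 θ.bV)
          (beta0OfMerged (betaMerged F (mergedTermFamilyMatT F N (TcanOfRecord F N) (chiFixed29 F N θ.ν θ.ε₂₉) θ.εbg) θ.ρ8 θ.bV) θ.v₀) θ.γ).β1 0 v| ≤ δ := by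
  letI := θ.instVβ₁; letI := θ.instVβ₂; letI := θ.instιβ
  obtain ⟨b, hb⟩ := hlim 0
  have hupd : ∀ g : ℝ, Function.update (θ.v₀ 0) (Fin.last 0) g = fun _ => g := fun g => by
    funext i
    rw [Subsingleton.elim (α := Fin 1) i (Fin.last 0)]
    simp
  simp only [hupd] at hb
  exact anchorZero_of_tendsto_betaMerged_zero θ hb

end Anchor

/-! ## §2. The `k = 0` rung of S2 ALREADY pays the `K ≥ 1` window at the record (K1⁷'s last conjunct ∕ K2⁷'s own window hypothesis) -/

section Window

/-- ★★ **ANCHOR₀ ⟹ THE `K ≥ 1` WINDOW AT THE STAGE-13 DATUM** (`0 < θ.γ`; every proviso witness `h`): the `k = 0` instance of line 2's S2 gives the one-sided limit of the merged first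
β-function (§1), hence — this seat's `…N13WindowAtRecord13SepCoPH.window_datumOfRecord₁₃SepCoPH_of_tendsto_betaMerged` BY NAME (`chiβOfRecord₁₃ = chiFixed29 … θ.ν θ.ε₂₉`, `rfl`) —
`∃ γ₁ > 0, ∀ γ ∈ ]0, γ₁], ∃ P, 1 ≤ P.K ∧ ((datumOfRecord₁₃SepCoPH F N θ h).C P).flow.InInterval γ P.K`.  So line 2's first rung discharges K2⁷'s OWN window hypothesis and K1⁷'s window
conjunct at once (given ANCHOR₀ — LOCATED, NODE O). [cite: Balaban1987RG1, (0.17)–(0.20) pp.255–256, (2.12)–(2.14) p.268; Balaban1989LargeFieldII, Thm 1 + (0.1) pp.355–356 (bookkeeping)] -/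
theorem window_datumOfRecord₁₃SepCoPH_of_anchorZero (θ : Stage13HParams F N) (h : θ.Provisos₁₃SepCoPH F N) (hγθ : 0 < θ.γ)
    (hA : letI := θ.instVβ₁; letI := θ.instVβ₂; letI := θ.instιβ
      ∀ δ : ℝ, 0 < δ → ∃ γ : ℝ, 0 < γ ∧ ∀ v ∈ Box γ 0,
        |(oneLoopSplit_betaOfMerged (betaMerged F (mergedTermFamilyMatT F N (TcanOfRecord F N) (chiFixed29 F N θ.ν θ.ε₂₉) θ.εbg) θ.ρ8 θ.bV)
            (beta0OfMerged (betaMerged F (mergedTermFamilyMatT F N (TcanOfRecord F N) (chiFixed29 F N θ.ν θ.ε₂₉) θ.εbg) θ.ρ8 θ.bV) θ.v₀) θ.γ).β1 0 v| ≤ δ) :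
    ∃ γ₁ : ℝ, 0 < γ₁ ∧ ∀ γ : ℝ, 0 < γ → γ ≤ γ₁ →
      ∃ P : B12.RunParams, 1 ≤ P.K ∧ ((datumOfRecord₁₃SepCoPH F N θ h).C P).flow.InInterval γ P.K := by
  letI := θ.instVβ₁; letI := θ.instVβ₂; letI := θ.instιβ
  exact window_datumOfRecord₁₃SepCoPH_of_tendsto_betaMerged θ h (tendsto_betaMerged_zero_of_anchorZero θ hγθ hA)

end Window

/-! ## §3. The `k = 0` rung of S3 is continuity of ONE real function on the half-open interval `]0, θ.γ]` -/

section Cont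

/-- ★ **CONT₀ ⟺ `ContinuousOn (g ↦ β_m 0 (g)) (Set.Ioc 0 θ.γ)`**: the `k = 0` instance of S3 `ContRecord13` = `ContinuousOn (betaOfMerged β_m β⁰ θ.γ 0) (Box θ.γ 0)` is — `Fin 1`-histories
being constant and the β of record BEING `β_m` on the box (`Node00.betaOfMerged_of_mem`) — continuity of the merged first β-function as a function of ONE real variable on `]0, θ.γ]`
(away from `0`; the behaviour AT `0⁺` is ANCHOR₀, §1 — logically independent). [cite: Balaban1987RG1, §1 p.264 («It is a C^∞-function of g … [0, γ]») and (1.22) p.264 (elementary)] -/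
theorem contZero_iff_continuousOn_Ioc (θ : Stage13HParams F N) :
    letI := θ.instVβ₁; letI := θ.instVβ₂; letI := θ.instιβ
    ContinuousOn
        (betaOfMerged (betaMerged F (mergedTermFamilyMatT F N (TcanOfRecord F N) (chiFixed29 F N θ.ν θ.ε₂₉) θ.εbg) θ.ρ8 θ.bV)
          (beta0OfMerged (betaMerged F (mergedTermFamilyMatT F N (TcanOfRecord F N) (chiFixed29 F N θ.ν θ.ε₂₉) θ.εbg) θ.ρ8 θ.bV) θ.v₀) θ.γ 0)
        (Box θ.γ 0) ↔
      ContinuousOn (fun g : ℝ => betaMerged F (mergedTermFamilyMatT F N (TcanOfRecord F N) (chiFixed29 F N θ.ν θ.ε₂₉) θ.εbg) θ.ρ8 θ.bV 0 (fun _ => g))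
        (Set.Ioc 0 θ.γ) := by
  letI := θ.instVβ₁; letI := θ.instVβ₂; letI := θ.instιβ
  set βm := betaMerged F (mergedTermFamilyMatT F N (TcanOfRecord F N) (chiFixed29 F N θ.ν θ.ε₂₉) θ.εbg) θ.ρ8 θ.bV with hβm
  set β0 := beta0OfMerged βm θ.v₀ with hβ0
  -- the two charts `g ↦ (g)` and `v ↦ v 0`
  have hconst : Continuous (fun g : ℝ => (fun _ : Fin 1 => g)) := continuous_pi fun _ => continuous_id
  have heval : Continuous (fun v : Fin 1 → ℝ => v 0) := continuous_apply 0
  have hmaps₁ : Set.MapsTo (fun g : ℝ => (fun _ : Fin 1 => g)) (Set.Ioc 0 θ.γ) (Box θ.γ 0) :=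
    fun g hg => const_mem_box_zero_iff.mpr ⟨hg.1, hg.2⟩
  have hmaps₂ : Set.MapsTo (fun v : Fin 1 → ℝ => v 0) (Box θ.γ 0) (Set.Ioc 0 θ.γ) :=
    fun v hv => ⟨((mem_box.mp hv) 0).1, ((mem_box.mp hv) 0).2⟩
  constructor
  · intro h
    -- `g ↦ betaOfMerged … 0 (g)` is continuous on `Ioc`, and equals `βm 0 (g)` there
    have h1 : ContinuousOn (fun g : ℝ => betaOfMerged βm β0 θ.γ 0 (fun _ => g)) (Set.Ioc 0 θ.γ) := h.comp hconst.continuousOn hmaps₁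
    refine h1.congr fun g hg => ?_
    exact (betaOfMerged_of_mem βm β0 θ.γ (const_mem_box_zero_iff.mpr ⟨hg.1, hg.2⟩)).symm
  · intro h
    have h1 : ContinuousOn (fun v : Fin 1 → ℝ => βm 0 (fun _ => v 0)) (Box θ.γ 0) := h.comp heval.continuousOn hmaps₂
    refine h1.congr fun v hv => ?_
    have hv0 : v = fun _ => v 0 := funext fun i => by rw [Subsingleton.elim (α := Fin 1) i 0]
    rw [betaOfMerged_of_mem βm β0 θ.γ hv]
    exact congrArg (βm 0) hv0

end Cont

/-! ## §4. At the registered texts' `N = 2` (the skeleton's spelling `chiFixed29 F 2 θ.ν θ.ε₂₉`) -/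

section Two

variable {F : T4Family}

/-- `N = 2`: the `k = 0` rung of `stub_anchor13`'s `D4AnchorRecord13` at `θ` ⟺ the `k = 0` instance of `Beta0LimitExists β_m θ.v₀` (`0 < θ.γ`). [cite: Balaban1987RG1, (2.12)–(2.14) p.268 (elementary)] -/
theorem anchorZero₂_iff_beta0LimitExists_zero (θ : Stage13HParams F 2) (hγθ : 0 < θ.γ) :
    letI := θ.instVβ₁; letI := θ.instVβ₂; letI := θ.instιβ
    (∀ δ : ℝ, 0 < δ → ∃ γ : ℝ, 0 < γ ∧ ∀ v ∈ Box γ 0,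
        |(oneLoopSplit_betaOfMerged (betaMerged F (mergedTermFamilyMatT F 2 (TcanOfRecord F 2) (chiFixed29 F 2 θ.ν θ.ε₂₉) θ.εbg) θ.ρ8 θ.bV)
            (beta0OfMerged (betaMerged F (mergedTermFamilyMatT F 2 (TcanOfRecord F 2) (chiFixed29 F 2 θ.ν θ.ε₂₉) θ.εbg) θ.ρ8 θ.bV) θ.v₀) θ.γ).β1 0 v| ≤ δ) ↔
      ∃ b : ℝ, Tendsto (fun g : ℝ => betaMerged F (mergedTermFamilyMatT F 2 (TcanOfRecord F 2) (chiFixed29 F 2 θ.ν θ.ε₂₉) θ.εbg) θ.ρ8 θ.bV 0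
        (Function.update (θ.v₀ 0) (Fin.last 0) g)) (𝓝[>] (0 : ℝ)) (𝓝 b) :=
  anchorZero_iff_beta0LimitExists_zero θ hγθ

/-- `N = 2`: ANCHOR₀ at `θ` ⟹ the window text of K1⁷ ∕ K2⁷ at `datumOfRecord₁₃SepCoPH F 2 θ h` (verbatim). [cite: Balaban1987RG1, (0.17)–(0.20) pp.255–256, (2.12)–(2.14) p.268; Balaban1989LargeFieldII, Thm 1 + (0.1) pp.355–356 (bookkeeping)] -/
theorem window₂_datumOfRecord₁₃SepCoPH_of_anchorZero (θ : Stage13HParams F 2) (h : θ.Provisos₁₃SepCoPH F 2) (hγθ : 0 < θ.γ)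
    (hA : letI := θ.instVβ₁; letI := θ.instVβ₂; letI := θ.instιβ
      ∀ δ : ℝ, 0 < δ → ∃ γ : ℝ, 0 < γ ∧ ∀ v ∈ Box γ 0,
        |(oneLoopSplit_betaOfMerged (betaMerged F (mergedTermFamilyMatT F 2 (TcanOfRecord F 2) (chiFixed29 F 2 θ.ν θ.ε₂₉) θ.εbg) θ.ρ8 θ.bV)
            (beta0OfMerged (betaMerged F (mergedTermFamilyMatT F 2 (TcanOfRecord F 2) (chiFixed29 F 2 θ.ν θ.ε₂₉) θ.εbg) θ.ρ8 θ.bV) θ.v₀) θ.γ).β1 0 v| ≤ δ) :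
    ∃ γ₁ : ℝ, 0 < γ₁ ∧ ∀ γ : ℝ, 0 < γ → γ ≤ γ₁ →
      ∃ P : Literature.MathematicalPhysics.QuantumFieldTheory.Balaban1983to89.B12.RunParams, 1 ≤ P.K ∧
        ((Literature.MathematicalPhysics.QuantumFieldTheory.Balaban1983to89.Node00.datumOfRecord₁₃SepCoPH F 2 θ h).C P).flow.InInterval γ P.K :=
  window_datumOfRecord₁₃SepCoPH_of_anchorZero θ h hγθ hA

end Two

end Summit.QuantumFields.YangMills.Theorems.BalabanUVNodesK2Line2FirstRungsAtScaleZero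

end
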